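import Summits.BirchSwinnertonDyer.BirchSwinnertonDyer.Theorems.GoldfeldAllTwistsTwoConverseTwinAdditiveRootNumber
import HarnessLib

set_option linter.dupNamespace false -- namespace `…BirchSwinnertonDyer.BirchSwinnertonDyer…` is the cell's (D-0017 nested layout)
set_option autoImplicit false

/-!
# Route `GoldfeldAllTwistsTwoConverse`, crux twin″ `BSDTwoCMSevenAdditiveRankOne` (item 19140):
# the SIGN of the additive cell (part 2) — parity of `r_an` on the cell and the item restricted to the
# NEGATIVE twists `49a1^{(d)}`, `d < 0`, `7 ∤ d`

Cell `bsd-goldfeld`, seat `bsd-goldfeld-s1p-c301` (prover, gen 3), item `stmt-BirchSwinnertonDyer-19140`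
(route decl `Summit.BirchSwinnertonDyer.BirchSwinnertonDyer.Theses.GoldfeldAllTwistsTwoConverse.BSDTwoCMSevenAdditiveRankOne`).
The item is OPEN mathematics; nothing here proves it. Theorems only: no definition, no axiom, no `sorry`,
no instance, no notation; every published input is an explicit named-fact binder.

Part 1 (`…TwinAdditiveRootNumber`) proved `w(49a1^{(d)}) = sign d` for every squarefree `d` with `7 ∤ d`
(from the tree's Murty–Murty / Atkin–Lehner twist formulas, `N(X₀(49)) = 49` decided by the kernel, and
`w(X₀(49)) = +1` ⟸ `L(X₀(49),1) ≠ 0`, binder `h12` = Coates–Li–Tian–Zhai Thm. 1.2 at `R = 1`). Here: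

* §4 PARITY ON THE CELL: every model `W ≅ 49a1^{(d)}` (`7 ∤ d`) has `w(W) = sign d`
  (`rootNumber_of_smul_eq_quadraticTwist_cm7`); for `d > 0` the analytic rank is EVEN
  (`even_analyticRank_of_smul_eq_quadraticTwist_cm7_of_pos` — Modularity's parity theorem — so `r_an ≠ 1`),
  for `d < 0` it is ODD (`odd_analyticRank_of_smul_eq_quadraticTwist_cm7_of_neg`, unconditional given the sign,
  so `r_an = 1 ↔ r_an ≤ 1`).
* §5 **THE ITEM LIVES ON THE NEGATIVE HALF**: granted Cassels (`hCassels`), GZK (`hGZK`), analytic continuation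
  (`hmod`), Modularity (`hnf`) and CLTZ Thm. 1.2 (`h12`),
  `bsdTwoCMSevenAdditiveRankOne_iff_negTwists`: twin″ ⟺ `BSD(W′,2)` for every globally minimal
  `W′ ≅ 49a1^{(d)}` with `d < 0` squarefree, `7 ∤ d`, `d ≢ 1 (mod 4)`, `r_an(W′) = 1`. The positive twists
  prime to `7` never have `r_an = 1` (§4), and `49a1^{(7e)} ∼ 49a1^{(−e)}` (the `7`-isogeny `[√−7]`, tree
  theorem `isIsogenous_quadraticTwist_cm7_neg_seven_mul`) moves the twists divisible by `7` into the family
  prime to `7` with `−e ≡ 7e (mod 4)`, `BSD(·,2)` being an isogeny invariant in analytic rank `≤ 1`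
  (`Wuthrich2014.bsdp_of_isIsogenous`). So the additive cell `r1.addv.borel.split` of the formula twin is,
  up to isogeny, exactly {`49a1^{(−m)}`, `49a1^{(−2m)}` (`m ≡ 1 (mod 4)`), `49a1^{(2m)}` (`m ≡ 3 (mod 4)`),
  `m > 0` squarefree prime to `7`, `L′(·,1) ≠ 0`} on minimal models — the families on which gen 2's
  2-isogeny descents (cell memo PRIME-TWIST-DESCENT.md) operate, all of root number `−1` as recorded there
  numerically; file 1's `bsdTwoCMSevenAdditiveRankOne_of_twists` (all `d ≢ 1 (mod 4)`) is halved.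

HONEST FRAMING: bookkeeping of the sign; the `2`-part of BSD for a single additive curve is not touched.

References: M. R. Murty, V. K. Murty, *Non-vanishing of L-functions and applications* (1997) Ch. 6 §1
[MurtyMurty1997]; J. H. Silverman, *AEC* (2009) C.16 Thm. 16.3 [SilvermanAEC2009]; J. Coates, Y. Li, Y. Tian,
S. Zhai, PLMS 110 (2015) Thm. 1.2, §1 (p. 359: `A^{(d)} ∼ A^{(−7d)}`) [CoatesLiTianZhai2015]; A. Barrios et al.
2025 Thm. 5.1 [BarriosEtAl2025]; J. S. Milne, *ADT* Thm. I.7.3 [MilneADT2006]; R. L. Miller, LMS JCM 14 (2011)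
Def. 1.1 [Miller2011LMS].
-/

noncomputable section

open scoped Classical

open WeierstrassCurve Literature.NumberTheory.EllipticCurves Literature.NumberTheory.EllipticCurves.ModularForms
  Literature.NumberTheory.EllipticCurves.Rank1Residual

namespace Summit.BirchSwinnertonDyer.BirchSwinnertonDyer.Theorems.GoldfeldGoodTwists

/-! ## §4 Parity on the cell: models of `49a1^{(d)}`, `7 ∤ d` — `r_an` is even for `d > 0`, odd for `d < 0` -/

/-- **Root number of any model.** If `C • W = 49a1^{(d)}` (`d` squarefree, `7 ∤ d`) then `w(W) = sign d`
(the root number is a `ℚ`-isomorphism invariant, `rootNumber_smul_holds`). [cite: MurtyMurty1997, Ch. 6 §1]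
[cite: SilvermanAEC2009, App. C §16 Thm. 16.3 with Prop. VII.1.3(b)] -/
theorem rootNumber_of_smul_eq_quadraticTwist_cm7 (hnf : exists_isNewformOf)
    (h12 : CoatesLiTianZhai2015.thm12_fullBSD_twist) {d : ℤ} (hsq : Squarefree d) (h7 : ¬ (7 : ℤ) ∣ d)
    (W : WeierstrassCurve ℚ) [W.IsElliptic] (C : VariableChange ℚ)
    (hC : C • W = cm7.quadraticTwist (d : ℚ)) : W.rootNumber = Int.sign d := by
  rw [← WeierstrassCurve.rootNumber_smul_holds W C, hC]
  exact rootNumber_quadraticTwist_cm7 hnf h12 hsq h7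

/-- **Positive twists have EVEN analytic rank.** If `C • W = 49a1^{(d)}` with `d > 0` squarefree, `7 ∤ d`,
then `ord_{s=1} L(W, s)` is even (`w(W) = +1` and the parity theorem from Modularity,
`even_analyticRank_iff_rootNumber_eq_one_of_exists_isNewformOf`). In particular `r_an(W) ≠ 1`: on the
POSITIVE half of the additive cell (`d > 0`, `7 ∤ d`) the hypothesis `r_an = 1` of twin″ is never met.
[cite: SilvermanAEC2009, C.16 Thm. 16.3 and remark, p. 451] [cite: MurtyMurty1997, Ch. 6 §1] -/
theorem even_analyticRank_of_smul_eq_quadraticTwist_cm7_of_pos (hnf : exists_isNewformOf)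
    (h12 : CoatesLiTianZhai2015.thm12_fullBSD_twist) {d : ℤ} (hsq : Squarefree d) (h7 : ¬ (7 : ℤ) ∣ d)
    (hd : 0 < d) (W : WeierstrassCurve ℚ) [W.IsElliptic] (C : VariableChange ℚ)
    (hC : C • W = cm7.quadraticTwist (d : ℚ)) : Even W.analyticRank :=
  (even_analyticRank_iff_rootNumber_eq_one_of_exists_isNewformOf W hnf).mpr
    (by rw [rootNumber_of_smul_eq_quadraticTwist_cm7 hnf h12 hsq h7 W C hC, Int.sign_eq_one_of_pos hd])

/-- `r_an(W) ≠ 1` for every model `W` of a positive twist `49a1^{(d)}`, `d > 0` squarefree, `7 ∤ d`.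
[cite: SilvermanAEC2009, C.16 Thm. 16.3 and remark, p. 451] -/
theorem analyticRank_ne_one_of_smul_eq_quadraticTwist_cm7_of_pos (hnf : exists_isNewformOf)
    (h12 : CoatesLiTianZhai2015.thm12_fullBSD_twist) {d : ℤ} (hsq : Squarefree d) (h7 : ¬ (7 : ℤ) ∣ d)
    (hd : 0 < d) (W : WeierstrassCurve ℚ) [W.IsElliptic] (C : VariableChange ℚ)
    (hC : C • W = cm7.quadraticTwist (d : ℚ)) : W.analyticRank ≠ 1 := fun h1 ↦ by
  have h := even_analyticRank_of_smul_eq_quadraticTwist_cm7_of_pos hnf h12 hsq h7 hd W C hC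
  rw [h1] at h
  exact absurd h (by decide)

/-- **Negative twists have ODD analytic rank** (hence `r_an ≥ 1`): if `C • W = 49a1^{(d)}` with `d < 0`
squarefree, `7 ∤ d`, then `w(W) = −1` and `ord_{s=1} L(W, s)` is odd — this direction of the parity fact
is unconditional given the sign (`odd_analyticRank_of_rootNumber_eq_neg_one`). [cite: SilvermanAEC2009, C.16 Thm. 16.3 and remark, p. 451] -/
theorem odd_analyticRank_of_smul_eq_quadraticTwist_cm7_of_neg (hnf : exists_isNewformOf)
    (h12 : CoatesLiTianZhai2015.thm12_fullBSD_twist) {d : ℤ} (hsq : Squarefree d) (h7 : ¬ (7 : ℤ) ∣ d)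
    (hd : d < 0) (W : WeierstrassCurve ℚ) [W.IsElliptic] (C : VariableChange ℚ)
    (hC : C • W = cm7.quadraticTwist (d : ℚ)) : Odd W.analyticRank :=
  odd_analyticRank_of_rootNumber_eq_neg_one
    (by rw [rootNumber_of_smul_eq_quadraticTwist_cm7 hnf h12 hsq h7 W C hC, Int.sign_eq_neg_one_of_neg hd])

/-- On the negative half, `r_an(W) = 1 ↔ r_an(W) ≤ 1` (odd and `≤ 1`): the item's hypothesis is the
Gross–Zagier–Kolyvagin range. [cite: SilvermanAEC2009, C.16 Thm. 16.3 and remark, p. 451] -/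
theorem analyticRank_eq_one_iff_le_one_of_smul_eq_quadraticTwist_cm7_of_neg (hnf : exists_isNewformOf)
    (h12 : CoatesLiTianZhai2015.thm12_fullBSD_twist) {d : ℤ} (hsq : Squarefree d) (h7 : ¬ (7 : ℤ) ∣ d)
    (hd : d < 0) (W : WeierstrassCurve ℚ) [W.IsElliptic] (C : VariableChange ℚ)
    (hC : C • W = cm7.quadraticTwist (d : ℚ)) : W.analyticRank = 1 ↔ W.analyticRank ≤ 1 := by
  refine ⟨fun h ↦ h.le, fun h ↦ ?_⟩
  obtain ⟨k, hk⟩ := odd_analyticRank_of_smul_eq_quadraticTwist_cm7_of_neg hnf h12 hsq h7 hd W C hC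
  omega

/-! ## §5 The item restricted to the NEGATIVE twists `49a1^{(d)}`, `d < 0`, `7 ∤ d`, `d ≢ 1 (mod 4)` -/

/-- **The `j = −3375` form of the item from BSD(·,2) on the NEGATIVE additive twists prime to `7`.**
Granted Cassels (`hCassels`), GZK (`hGZK`), analytic continuation (`hmod`), Modularity (`hnf`) and CLTZ Thm. 1.2
at `R = 1` (`h12`, for `w(X₀(49)) = +1`): if `BSD(W′,2)` holds for every globally minimal model `W′` of every
twist `49a1^{(d)}` with `d < 0` squarefree, `7 ∤ d`, `d ≢ 1 (mod 4)`, of analytic rank `1`, then it holds for every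
globally minimal `W` with `j = −3375`, bad at `2`, `r_an = 1`. Proof: `W ≅ 49a1^{(d)}`, `d ≢ 1 (mod 4)` (file 1);
if `7 ∤ d` then `d > 0` is excluded by §4 (`r_an` even), so `d < 0`; if `d = 7e` then `49a1^{(7e)} ∼ 49a1^{(−e)}`
(the `7`-isogeny `[√−7]`, tree theorem `isIsogenous_quadraticTwist_cm7_neg_seven_mul`), `−e ≡ d (mod 4)`, `7 ∤ e`,
`r_an` is an isogeny invariant, so again `−e < 0` by §4, and `BSD(·,2)` transports back along the isogeny
(`Wuthrich2014.bsdp_of_isIsogenous`). [cite: MilneADT2006, Thm. I.7.3] [cite: CoatesLiTianZhai2015, §1 (p. 359: A^{(d)} ∼ A^{(−7d)})]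
[cite: MurtyMurty1997, Ch. 6 §1] -/
theorem bsdTwo_j_neg3375_additive_of_negTwists (hCassels : bsdRHS_eq_of_isIsogenous)
    (hGZK : rank_eq_analyticRank_of_analyticRank_le_one) (hmod : hasEntireLFunction_rat)
    (hnf : exists_isNewformOf) (h12 : CoatesLiTianZhai2015.thm12_fullBSD_twist)
    (h : ∀ (d : ℤ), d < 0 → Squarefree d → ¬ (7 : ℤ) ∣ d → d % 4 ≠ 1 →
      ∀ (W' : WeierstrassCurve ℚ) [W'.IsElliptic] [W'.IsGloballyMinimal] (C : VariableChange ℚ),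
        C • W' = cm7.quadraticTwist (d : ℚ) → W'.analyticRank = 1 → BSDp W' 2) :
    ∀ (W : WeierstrassCurve ℚ) [W.IsElliptic] [W.IsGloballyMinimal],
      W.j = -3375 → ¬ W.HasGoodReductionAtPrime 2 → W.analyticRank = 1 → BSDp W 2 := by
  intro W _ _ hj hg har
  haveI : Fact (Nat.Prime 2) := ⟨Nat.prime_two⟩
  obtain ⟨d, hd0, hsq, hd4, C, hC⟩ := exists_squarefree_twist_of_j_neg3375_of_not_good_two W hj hg
  by_cases h7 : (7 : ℤ) ∣ d
  · -- `d = 7e`: pass to the isogenous twist by `−e`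
    obtain ⟨e, rfl⟩ := h7
    have he0 : -e ≠ 0 := by intro h0; apply hd0; omega
    have heQ : ((-e : ℤ) : ℚ) ≠ 0 := Int.cast_ne_zero.mpr he0
    have hsqe : Squarefree (-e) := hsq.squarefree_of_dvd ⟨-7, by ring⟩
    have h7e : ¬ (7 : ℤ) ∣ -e := by
      rintro ⟨f, hf⟩
      have : (7 * 7 : ℤ) ∣ 7 * e := ⟨-f, by linarith⟩
      exact absurd (Int.isUnit_iff.mp (hsq 7 this)) (by decide)
    have he4 : (-e) % 4 ≠ 1 := by omega
    -- a globally minimal model `W''` of `49a1^{(−e)}`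
    obtain ⟨W'', hE'', hmin'', C'', hC''⟩ := exists_isGloballyMinimal_smul_eq_quadraticTwist cm7 heQ
    -- `W ∼ W''`
    haveI := cm7.isElliptic_quadraticTwist (Int.cast_ne_zero.mpr hd0 : ((7 * e : ℤ) : ℚ) ≠ 0)
    haveI := cm7.isElliptic_quadraticTwist heQ
    have hiso : IsIsogenous W W'' := by
      have h1 : IsIsogenous W (cm7.quadraticTwist ((7 * e : ℤ) : ℚ)) := by
        rw [← hC]; exact (isIsogenous_self W).smul_right C
      have h2 : IsIsogenous (cm7.quadraticTwist ((7 * e : ℤ) : ℚ)) (cm7.quadraticTwist ((-e : ℤ) : ℚ)) := by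
        have h := isIsogenous_quadraticTwist_cm7_neg_seven_mul he0
        rw [show (-7 * -e : ℤ) = 7 * e by ring] at h
        exact h.symm_of_isElliptic
      have h3 : IsIsogenous (cm7.quadraticTwist ((-e : ℤ) : ℚ)) W'' := by
        have h := (isIsogenous_self (C'' • W'')).smul_right C''⁻¹
        rw [inv_smul_smul] at h
        rwa [hC''] at h
      exact (h1.trans' h2).trans' h3
    have har'' : W''.analyticRank = 1 := by rw [← analyticRank_eq_of_isIsogenous' hiso]; exact har
    -- sign: `−e < 0`
    have hneg : -e < 0 := by
      by_contra hle
      have hpos : 0 < -e := lt_of_le_of_ne (not_lt.mp hle) (Ne.symm he0)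
      exact analyticRank_ne_one_of_smul_eq_quadraticTwist_cm7_of_pos hnf h12 hsqe h7e hpos W'' C'' hC'' har''
    obtain ⟨-, hfin''⟩ := hGZK W'' (by rw [har''])
    exact Wuthrich2014.bsdp_of_isIsogenous hCassels hiso hfin''
      (WeierstrassCurve.leadingLCoeff_ne_zero_holds (hmod W'')) (h (-e) hneg hsqe h7e he4 W'' C'' hC'' har'')
  · -- `7 ∤ d`: the sign forces `d < 0`
    have hneg : d < 0 := by
      by_contra hle
      have hpos : 0 < d := lt_of_le_of_ne (not_lt.mp hle) (Ne.symm hd0)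
      exact analyticRank_ne_one_of_smul_eq_quadraticTwist_cm7_of_pos hnf h12 hsq h7 hpos W C hC har
    exact h d hneg hsq h7 hd4 W C hC har

/-- **The item from BSD(·,2) on the NEGATIVE additive twists prime to `7`** (twin″ lives on `d < 0`):
granted Cassels/GZK/continuation/Modularity/CLTZ 1.2, `BSD(·,2)` for the minimal models of the analytic-rank-one
twists `49a1^{(d)}`, `d < 0` squarefree, `7 ∤ d`, `d ≢ 1 (mod 4)`, implies
`Theses.GoldfeldAllTwistsTwoConverse.BSDTwoCMSevenAdditiveRankOne`. Halves file 1's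
`bsdTwoCMSevenAdditiveRankOne_of_twists` (all `d ≢ 1 (mod 4)`): the positive half is VACUOUS by sign.
[cite: MilneADT2006, Thm. I.7.3] [cite: MurtyMurty1997, Ch. 6 §1] [cite: Miller2011LMS, Def. 1.1] -/
theorem bsdTwoCMSevenAdditiveRankOne_of_negTwists (hCassels : bsdRHS_eq_of_isIsogenous)
    (hGZK : rank_eq_analyticRank_of_analyticRank_le_one) (hmod : hasEntireLFunction_rat)
    (hnf : exists_isNewformOf) (h12 : CoatesLiTianZhai2015.thm12_fullBSD_twist)
    (h : ∀ (d : ℤ), d < 0 → Squarefree d → ¬ (7 : ℤ) ∣ d → d % 4 ≠ 1 →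
      ∀ (W' : WeierstrassCurve ℚ) [W'.IsElliptic] [W'.IsGloballyMinimal] (C : VariableChange ℚ),
        C • W' = cm7.quadraticTwist (d : ℚ) → W'.analyticRank = 1 → BSDp W' 2) :
    Summit.BirchSwinnertonDyer.BirchSwinnertonDyer.Theses.GoldfeldAllTwistsTwoConverse.BSDTwoCMSevenAdditiveRankOne :=
  bsdTwoCMSevenAdditiveRankOne_of_j_neg3375 hCassels hGZK hmod
    (bsdTwo_j_neg3375_additive_of_negTwists hCassels hGZK hmod hnf h12 h)

/-- **Conversely (unconditional): the item gives `BSD(W′,2)` for every minimal model `W′` of a negative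
additive twist `49a1^{(d)}` (`d < 0`, `d ≢ 1 (mod 4)`) of analytic rank one** — such a `W′` is bad at `2`
(Barrios et al. rows `I₀`). [cite: BarriosEtAl2025, Thm. 5.1 (rows R = I₀)] [cite: Miller2011LMS, Def. 1.1] -/
theorem bsdTwo_negTwists_of_bsdTwoCMSevenAdditiveRankOne
    (h : Summit.BirchSwinnertonDyer.BirchSwinnertonDyer.Theses.GoldfeldAllTwistsTwoConverse.BSDTwoCMSevenAdditiveRankOne) :
    ∀ (d : ℤ), d < 0 → Squarefree d → ¬ (7 : ℤ) ∣ d → d % 4 ≠ 1 →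
      ∀ (W' : WeierstrassCurve ℚ) [W'.IsElliptic] [W'.IsGloballyMinimal] (C : VariableChange ℚ),
        C • W' = cm7.quadraticTwist (d : ℚ) → W'.analyticRank = 1 → BSDp W' 2 := by
  intro d hd hsq _ hd4 W' _ _ C hC har
  haveI : Fact (Nat.Prime 2) := ⟨Nat.prime_two⟩
  have hsq4 : ¬ (4 : ℤ) ∣ d := fun h4 ↦ by
    have : (2 * 2 : ℤ) ∣ d := by simpa using h4
    exact absurd (Int.isUnit_iff.mp (hsq 2 this)) (by decide)
  have hg : ¬ W'.HasGoodReductionAtPrime 2 :=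
    not_hasGoodReductionAtPrime_two_of_smul_eq_quadraticTwist cm7 W' hasGoodReductionAtPrime_cm7_two
      (d := d) (by omega) hC
  exact bsdTwo_twists_additive_of_bsdTwoCMSevenAdditiveRankOne h hd.ne W' C hC hg har

/-- **twin″ ⟺ BSD(·,2) on the negative additive twists prime to `7`**, granted Cassels/GZK/continuation/
Modularity/CLTZ 1.2 (for the direction ⟸ only). The additive cell of the formula twin at `2` IS, up to
`ℚ`-isogeny transport, the statement: for every `d < 0` squarefree with `7 ∤ d`, `d ≢ 1 (mod 4)`, and every
globally minimal `W′ ≅ 49a1^{(d)}` with `ord_{s=1} L(W′, s) = 1`, Miller's `BSD(W′, 2)` holds.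
[cite: MilneADT2006, Thm. I.7.3] [cite: MurtyMurty1997, Ch. 6 §1] [cite: Miller2011LMS, Def. 1.1] -/
theorem bsdTwoCMSevenAdditiveRankOne_iff_negTwists (hCassels : bsdRHS_eq_of_isIsogenous)
    (hGZK : rank_eq_analyticRank_of_analyticRank_le_one) (hmod : hasEntireLFunction_rat)
    (hnf : exists_isNewformOf) (h12 : CoatesLiTianZhai2015.thm12_fullBSD_twist) :
    Summit.BirchSwinnertonDyer.BirchSwinnertonDyer.Theses.GoldfeldAllTwistsTwoConverse.BSDTwoCMSevenAdditiveRankOne ↔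
      ∀ (d : ℤ), d < 0 → Squarefree d → ¬ (7 : ℤ) ∣ d → d % 4 ≠ 1 →
        ∀ (W' : WeierstrassCurve ℚ) [W'.IsElliptic] [W'.IsGloballyMinimal] (C : VariableChange ℚ),
          C • W' = cm7.quadraticTwist (d : ℚ) → W'.analyticRank = 1 → BSDp W' 2 :=
  ⟨bsdTwo_negTwists_of_bsdTwoCMSevenAdditiveRankOne,
    bsdTwoCMSevenAdditiveRankOne_of_negTwists hCassels hGZK hmod hnf h12⟩

end Summit.BirchSwinnertonDyer.BirchSwinnertonDyer.Theorems.GoldfeldGoodTwists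

end
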